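import Summits.ABC.ABC.Theses.CubicResolventAllowance
import Summits.ABC.ABC.Theorems.CubicResolventAllowanceResolventDiscBounds
import Summits.ABC.ABC.Theorems.NumberFieldRamificationDiscr
import Literature.NumberTheory.CubicFields.CubicFieldGaloisIffSquareDiscriminant
import Mathlib.NumberTheory.Zsqrtd.Basic
import Mathlib.NumberTheory.RamificationInertia.Galois
import HarnessLib

/-!
# STUB-IDEAS `stub_realCubic` · ideator k2 (HOME FAMILY 2 — RESHAPE) · generation 9 — ELIMINATE THE FIELD

Crux stmt-ABC-22740 `CubicResolventAllowance.IndexSzpiro`, stub `stub_realCubic` (the `0 < d_K` half),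
route-ABC-CubicResolventAllowance.  Two reshapes that remove the cubic field `K` from the statement:

* **§A (the cyclic leaf, uniformly over `ℤ[√-3]`).**  `K` Galois ⟺ `d_K = □` (tree) ⟺ `Δ = δ²`; then the
  CARDANO ELEMENT `γ_E = c₆ + 24·δ·√-3` has `N(γ_E) = c₄³` (A2, proved), `j = 1728 + (c₆/δ)²` (A3, proved:
  the leaf is `X_ns(2) ≅ ℙ¹`), `K` is the cyclic cubic field of the Kummer class `[γ_E] ∈ ℚ(ω)^×/cubes`, and the
  allowance collapses: odd multiplicative primes are unramified in `K` (A4+A5, proved modulo k3-g8 H2),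
  `|d_K|·oddMultRad ∣ 216·N` (A6), so the stub on the leaf is allowance-free Szpiro diluted only by `N/oddMultRad`
  (A7, proved from A6).  The leaf lies ENTIRELY in the real half (A1': square ⟹ positive; proved).
* **§B (all of the class, prime by prime).**  For `p ≥ 5`: `v_p(d_K) = κ_p := (n_p mod 2) + 2·[p potentially
  good ∧ 3 ∤ n_p]`, `n_p = v_p(Δ_min)` (B2, the ALLOWANCE TABLE; derivation: `ℚ(E[2]) ⊂ ℚ(√Δ, ω, ∛γ_E)`,
  inertia of order `2^[n_p odd]·3^[3∤n_p]` at potentially good `p ≥ 5`, Tate curve at potentially multiplicative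
  `p`, tame conductor–discriminant for the cubic subfield).  Hence `StubRealCubic ↔ StubRealKfree` (B4, proved
  from the two divisibilities B3a/B3b), a statement about `(n_p, f_p, sign v_p(j))_p` alone.
Sorries: exactly A6, A8, B3a, B3b (each ≤ 1 prover cycle, plans in the docstrings) — everything else is proved.
-/

set_option linter.dupNamespace false

noncomputable section

open scoped NumberField
open NumberField IsDedekindDomain Ideal Polynomial WeierstrassCurve

namespace Summit.ABC.ABC.Cruxes.IndexSzpiro.StubIdeas2RealG9

open Summit.ABC.ABC.Theses.CubicResolventAllowance Summit.ABC.ABC.Theorems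

/-! ## §0 The stub, verbatim -/

/-- The registered stub `stub_realCubic`, verbatim. -/
def StubRealCubic : Prop :=
  ∀ ε : ℝ, 0 < ε → ∃ C : ℝ, ∀ (W : WeierstrassCurve ℚ) [W.IsElliptic] (K : Type) [Field K] [NumberField K],
    Irreducible W.twoTorsionPolynomial.toPoly → Module.finrank ℚ K = 3 →
    (∃ θ : K, aeval θ W.twoTorsionPolynomial.toPoly = 0) → 0 < NumberField.discr K →
    (W.minimalDiscriminantNorm ℤ : ℝ) ≤ C * |(NumberField.discr K : ℝ)| * (W.conductorNorm ℤ : ℝ) ^ (6 + ε)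

/-! ## §A The cyclic leaf -/

/-- The stub on the GALOIS (cyclic, `C₃`) leaf.  No sign hypothesis: it is automatic (A1'). -/
def StubRealGalois : Prop :=
  ∀ ε : ℝ, 0 < ε → ∃ C : ℝ, ∀ (W : WeierstrassCurve ℚ) [W.IsElliptic] (K : Type) [Field K] [NumberField K],
    Irreducible W.twoTorsionPolynomial.toPoly → Module.finrank ℚ K = 3 →
    (∃ θ : K, aeval θ W.twoTorsionPolynomial.toPoly = 0) → IsGalois ℚ K →
    (W.minimalDiscriminantNorm ℤ : ℝ) ≤ C * |(NumberField.discr K : ℝ)| * (W.conductorNorm ℤ : ℝ) ^ (6 + ε)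

/-- The stub on the GENERIC (`S₃`, real) leaf. -/
def StubRealGeneric : Prop :=
  ∀ ε : ℝ, 0 < ε → ∃ C : ℝ, ∀ (W : WeierstrassCurve ℚ) [W.IsElliptic] (K : Type) [Field K] [NumberField K],
    Irreducible W.twoTorsionPolynomial.toPoly → Module.finrank ℚ K = 3 →
    (∃ θ : K, aeval θ W.twoTorsionPolynomial.toPoly = 0) → ¬ IsGalois ℚ K → 0 < NumberField.discr K →
    (W.minimalDiscriminantNorm ℤ : ℝ) ≤ C * |(NumberField.discr K : ℝ)| * (W.conductorNorm ℤ : ℝ) ^ (6 + ε)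

/-- **A1' (S, PROVED).** A Galois cubic field has POSITIVE discriminant (`d_K = □ ≠ 0`): the cyclic leaf lies
entirely in the real half; the complex stub never sees it. [cite: CohenGTM138, §6.4.5] -/
theorem discr_pos_of_isGalois (K : Type) [Field K] [NumberField K] (hK : Module.finrank ℚ K = 3)
    [IsGalois ℚ K] : 0 < NumberField.discr K := by
  obtain ⟨r, hr⟩ := (Literature.NumberTheory.CubicFields.isGalois_iff_isSquare_discr_cubic K hK).mp ‹_›
  have h0 : NumberField.discr K ≠ 0 := NumberField.discr_ne_zero K
  rcases lt_trichotomy 0 (NumberField.discr K) with h | h | h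
  · exact h
  · exact absurd h.symm h0
  · exact absurd (hr ▸ mul_self_nonneg r) (not_le.mpr h)

/-- … so a class member with `d_K < 0` is never Galois (the complex twin's leaf is empty). PROVED. -/
theorem not_isGalois_of_discr_neg (K : Type) [Field K] [NumberField K] (hK : Module.finrank ℚ K = 3)
    (h : NumberField.discr K < 0) : ¬ IsGalois ℚ K := fun _ =>
  absurd (discr_pos_of_isGalois K hK) (not_lt.mpr h.le)

/-- **A1 (XS, PROVED).** The leaf dichotomy: `stub ↔ Galois leaf ∧ generic leaf`. -/
theorem stubRealCubic_iff_leaves : StubRealCubic ↔ StubRealGalois ∧ StubRealGeneric := by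
  constructor
  · intro h
    refine ⟨fun ε hε => ?_, fun ε hε => ?_⟩
    · obtain ⟨C, hC⟩ := h ε hε
      exact ⟨C, fun W _ K _ _ hirr hK hθ hG => hC W K hirr hK hθ (@discr_pos_of_isGalois K _ _ hK hG)⟩
    · obtain ⟨C, hC⟩ := h ε hε
      exact ⟨C, fun W _ K _ _ hirr hK hθ _ hd => hC W K hirr hK hθ hd⟩
  · rintro ⟨hg, hn⟩ ε hε
    obtain ⟨C₁, h₁⟩ := hg ε hε
    obtain ⟨C₂, h₂⟩ := hn ε hε
    refine ⟨max C₁ C₂, fun W _ K _ _ hirr hK hθ hd => ?_⟩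
    have hN : (0 : ℝ) ≤ (W.conductorNorm ℤ : ℝ) ^ (6 + ε) := Real.rpow_nonneg (Nat.cast_nonneg _) _
    by_cases hG : IsGalois ℚ K
    · exact (h₁ W K hirr hK hθ hG).trans
        (mul_le_mul_of_nonneg_right (mul_le_mul_of_nonneg_right (le_max_left _ _) (abs_nonneg _)) hN)
    · exact (h₂ W K hirr hK hθ hG hd).trans
        (mul_le_mul_of_nonneg_right (mul_le_mul_of_nonneg_right (le_max_right _ _) (abs_nonneg _)) hN)

/-- **A2 (S, PROVED) — the Cardano element, general form.** For ANY Weierstrass curve over `ℤ`,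
`γ = c₆ + 24·√(-3Δ)` has norm `c₄³` in `ℤ√(-3Δ)` (`1728 = 3·24²`, Mathlib `c_relation`).  `ℚ(E[2])` is generated
over `ℚ(√Δ, ω)` by `∛γ` (Cardano); on the cyclic leaf `-3Δ = -3δ²` and `γ` lives in `ℤ[√-3]` (A2'). [folklore] -/
theorem cardano_norm (W : WeierstrassCurve ℤ) : (⟨W.c₆, 24⟩ : ℤ√(-3 * W.Δ)).norm = W.c₄ ^ 3 := by
  rw [Zsqrtd.norm_def]
  linear_combination W.c_relation

/-- **A2' (S, PROVED) — the Cardano element on the cyclic leaf.** `Δ = δ²` ⟹ `N_{ℚ(√-3)/ℚ}(c₆ + 24δ√-3) = c₄³`.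
So the leaf, uniformly in `K`, is the cube-norm cone `{γ ∈ ℤ[√-3] : N γ ∈ ℤ³}`; `K` = the cyclic cubic field of
the Kummer class of `γ` (irreducible `ψ₂` ⟺ `γ ∉ ℚ^×·(ℚ(ω)^×)³`), `f_K` = product of the split primes `p ≡ 1 (3)`
with `3 ∤ v_π(γ)` (A8, A9). [folklore] -/
theorem cardano_norm_leaf (W : WeierstrassCurve ℤ) {δ : ℤ} (hΔ : W.Δ = δ ^ 2) :
    (⟨W.c₆, 24 * δ⟩ : ℤ√(-3)).norm = W.c₄ ^ 3 := by
  rw [Zsqrtd.norm_def]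
  linear_combination W.c_relation - 1728 * hΔ

/-- **A3 (S, PROVED) — the leaf is `X_ns(2)`:** `Δ = δ²` ⟹ `j = 1728 + (c₆/δ)²` (cf. k3 g1 PB2, sorry'd there,
`IsSquare d_K ↔ IsSquare (j - 1728)`). [folklore] -/
theorem j_eq_of_Δ_eq_sq {F : Type*} [Field F] (W : WeierstrassCurve F) [W.IsElliptic] {δ : F}
    (hΔ : W.Δ = δ ^ 2) : W.j = 1728 + (W.c₆ / δ) ^ 2 := by
  have hδ : δ ≠ 0 := by
    rintro rfl
    exact W.Δ'.ne_zero (by rw [W.coe_Δ', hΔ]; ring)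
  have hj : W.j = W.c₄ ^ 3 / W.Δ := by
    rw [WeierstrassCurve.j, Units.val_inv_eq_inv_val, W.coe_Δ', div_eq_inv_mul]
  rw [hj, hΔ]
  field_simp
  linear_combination 1728 * hΔ - W.c_relation

/-- **A4 (S, PROVED) — Galois cubic ⟹ `e(P|p) ∣ 3`** (fundamental identity `g·e·f = |Gal| = 3`, Mathlib
`Ideal.ncard_primesOver_mul_ramificationIdxIn_mul_inertiaDegIn`). [cite: NeukirchANT1999, Ch. I §9 (9.6)] -/
theorem ramificationIdx_dvd_three_of_isGalois (K : Type) [Field K] [NumberField K] [IsGalois ℚ K]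
    (hK : Module.finrank ℚ K = 3) (P : Ideal (𝓞 K)) [P.IsMaximal] : P.ramificationIdx ℤ ∣ 3 := by
  haveI : IsGaloisGroup (K ≃ₐ[ℚ] K) ℤ (𝓞 K) := IsGaloisGroup.of_isFractionRing _ _ _ ℚ K
  have h := Ideal.ncard_primesOver_mul_ramificationIdxIn_mul_inertiaDegIn (P.under ℤ) (𝓞 K) (K ≃ₐ[ℚ] K)
  rw [Ideal.ramificationIdxIn_eq_ramificationIdx (P.under ℤ) P (K ≃ₐ[ℚ] K),
    Ideal.inertiaDegIn_eq_inertiaDeg (P.under ℤ) P (K ≃ₐ[ℚ] K), IsGalois.card_aut_eq_finrank, hK] at h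
  exact ⟨((P.under ℤ).primesOver (𝓞 K)).ncard * P.inertiaDeg ℤ, by rw [← h]; ring⟩

/-- **A5 (S, PROVED modulo its hypothesis `h2` = k3-g8 H2 at this prime).** On the Galois leaf an odd
multiplicative prime (every `P | p` has `e ≤ 2`, Tate curve at level 2) is UNRAMIFIED in `K`: `e ∣ 3 ∧ e ≤ 2 ⟹ e = 1`,
then Dedekind (tree `padicValNat_discr_eq_zero_of_forall_ramificationIdx_eq_one`). [cite: NeukirchANT1999, Ch. III (2.6)] -/
theorem padicValNat_discr_eq_zero_of_isGalois (K : Type) [Field K] [NumberField K] [IsGalois ℚ K]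
    (hK : Module.finrank ℚ K = 3) {p : ℕ} (hp : p.Prime)
    (h2 : ∀ (P : Ideal (𝓞 K)) [P.IsMaximal], (p : 𝓞 K) ∈ P → P.ramificationIdx ℤ ≤ 2) :
    padicValNat p (NumberField.discr K).natAbs = 0 := by
  refine padicValNat_discr_eq_zero_of_forall_ramificationIdx_eq_one K hp fun P _ hpP => ?_
  have hdvd := ramificationIdx_dvd_three_of_isGalois K hK P
  have hle := h2 P hpP
  rcases (Nat.dvd_prime Nat.prime_three).mp hdvd with h | h <;> omega

/-- The odd multiplicative radical `∏ {p odd prime : f_p(E) = 1}`. -/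
def oddMultRad (W : WeierstrassCurve ℚ) [W.IsElliptic] : ℕ :=
  ∏ p ∈ (W.conductorNorm ℤ).primeFactors.filter (fun p => p ≠ 2 ∧ (W.conductorNorm ℤ).factorization p = 1), p

/-- **A6 (M) — the allowance COLLAPSES on the cyclic leaf: `|d_K|·oddMultRad ∣ 216·N`** (k3 g1 PB3, now
closable).  Prime by prime (`Nat.factorization_prime_le_iff_dvd`, template tree `dvd_mul_sq_of_padicValNat_le`):
odd `p` with `f_p = 1`: `v_p(d_K) = 0` (A5 with k3-g8 H2: `ramificationIdx_divisionField_self_dvd_level_of_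
hasMultiplicativeReductionAt`, `exists_ringHom_divisionField_two`, `Ideal.ramificationIdx_below_le`) and
`v_p(oddMultRad) = 1 = v_p(N)`; `p = 2`: `v₂(d_K) ≤ 3` (`padicValNat_two_discr_le_three`); `p = 3` additive:
`≤ 5 ≤ 3 + f₃` (`padicValNat_three_discr_le_five`); `p ≥ 5` additive: `≤ 2 = f_p`; `p ∤ N`: `0` (NOS,
`not_dvd_discr_divisionField_two` + `discr_dvd_discr`).  Census j345123 (this page): 0 violations.
[cite: SilvermanATAEC1994, V.4–V.5 and Exercise 5.13 (b)] -/
theorem natAbs_discr_mul_oddMultRad_dvd (W : WeierstrassCurve ℚ) [W.IsElliptic]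
    (K : Type) [Field K] [NumberField K] [IsGalois ℚ K] (hirr : Irreducible W.twoTorsionPolynomial.toPoly)
    (hK : Module.finrank ℚ K = 3) (hθ : ∃ θ : K, aeval θ W.twoTorsionPolynomial.toPoly = 0) :
    (NumberField.discr K).natAbs * oddMultRad W ∣ 216 * W.conductorNorm ℤ := by
  sorry

/-- A6 as a named hypothesis (for the glue A7). -/
def LeafAllowanceCollapse : Prop :=
  ∀ (W : WeierstrassCurve ℚ) [W.IsElliptic] (K : Type) [Field K] [NumberField K], IsGalois ℚ K →
    Irreducible W.twoTorsionPolynomial.toPoly → Module.finrank ℚ K = 3 →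
    (∃ θ : K, aeval θ W.twoTorsionPolynomial.toPoly = 0) →
    (NumberField.discr K).natAbs * oddMultRad W ∣ 216 * W.conductorNorm ℤ

theorem leafAllowanceCollapse_holds : LeafAllowanceCollapse :=
  fun W _ K _ _ hG hirr hK hθ => @natAbs_discr_mul_oddMultRad_dvd W _ K _ _ hG hirr hK hθ

/-- **A7 (S, PROVED from A6) — what the stub SAYS on the cyclic leaf:** `Δ_min · oddMultRad ≤ 216·C·N^{7+ε}`,
i.e. `Δ_min ≤ 216 C · (N / oddMultRad) · N^{6+ε}` — Szpiro `6+ε` whose only allowance is the non-(odd-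
multiplicative) part of the conductor: the resolvent allowance is VOID on the leaf. -/
theorem leaf_consequence_of_stub (h : StubRealCubic) (hA : LeafAllowanceCollapse) :
    ∀ ε : ℝ, 0 < ε → ∃ C : ℝ, ∀ (W : WeierstrassCurve ℚ) [W.IsElliptic] (K : Type) [Field K] [NumberField K],
      IsGalois ℚ K → Irreducible W.twoTorsionPolynomial.toPoly → Module.finrank ℚ K = 3 →
      (∃ θ : K, aeval θ W.twoTorsionPolynomial.toPoly = 0) →
      (W.minimalDiscriminantNorm ℤ : ℝ) * (oddMultRad W : ℝ) ≤ 216 * C * (W.conductorNorm ℤ : ℝ) ^ (7 + ε) := by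
  intro ε hε
  obtain ⟨C, hC⟩ := h ε hε
  refine ⟨max C 0, fun W _ K _ _ hG hirr hK hθ => ?_⟩
  haveI := hG
  have hd := discr_pos_of_isGalois K hK
  have h1 := hC W K hirr hK hθ hd
  have hNpos : (0 : ℝ) < (W.conductorNorm ℤ : ℝ) := by exact_mod_cast W.conductorNorm_pos_holds
  have hN0 : (0 : ℝ) ≤ (W.conductorNorm ℤ : ℝ) ^ (6 + ε) := Real.rpow_nonneg hNpos.le _
  have hmax0 : (0 : ℝ) ≤ max C 0 := le_max_right _ _
  have hr0 : (0 : ℝ) ≤ (oddMultRad W : ℝ) := Nat.cast_nonneg _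
  have hdvd := hA W K hG hirr hK hθ
  have hM : 0 < 216 * W.conductorNorm ℤ := Nat.mul_pos (by norm_num) (W.conductorNorm_pos_holds : 0 < W.conductorNorm ℤ)
  have hle : ((NumberField.discr K).natAbs * oddMultRad W : ℕ) ≤ 216 * W.conductorNorm ℤ :=
    Nat.le_of_dvd hM hdvd
  have hleR : |(NumberField.discr K : ℝ)| * (oddMultRad W : ℝ) ≤ 216 * (W.conductorNorm ℤ : ℝ) := by
    have h' : (((NumberField.discr K).natAbs : ℕ) : ℝ) * (oddMultRad W : ℝ) ≤ 216 * (W.conductorNorm ℤ : ℝ) := by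
      exact_mod_cast hle
    have habs : |(NumberField.discr K : ℝ)| = (((NumberField.discr K).natAbs : ℕ) : ℝ) := by
      rw [Nat.cast_natAbs, Int.cast_abs]
    rwa [habs]
  have hsplit : (W.conductorNorm ℤ : ℝ) ^ (7 + ε) = (W.conductorNorm ℤ : ℝ) * (W.conductorNorm ℤ : ℝ) ^ (6 + ε) := by
    rw [show (7 : ℝ) + ε = 1 + (6 + ε) by ring, Real.rpow_add hNpos, Real.rpow_one]
  calc (W.minimalDiscriminantNorm ℤ : ℝ) * (oddMultRad W : ℝ)
      ≤ (C * |(NumberField.discr K : ℝ)| * (W.conductorNorm ℤ : ℝ) ^ (6 + ε)) * (oddMultRad W : ℝ) :=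
        mul_le_mul_of_nonneg_right h1 hr0
    _ ≤ (max C 0 * |(NumberField.discr K : ℝ)| * (W.conductorNorm ℤ : ℝ) ^ (6 + ε)) * (oddMultRad W : ℝ) :=
        mul_le_mul_of_nonneg_right (mul_le_mul_of_nonneg_right
          (mul_le_mul_of_nonneg_right (le_max_left _ _) (abs_nonneg _)) hN0) hr0
    _ = max C 0 * (|(NumberField.discr K : ℝ)| * (oddMultRad W : ℝ)) * (W.conductorNorm ℤ : ℝ) ^ (6 + ε) := by ring
    _ ≤ max C 0 * (216 * (W.conductorNorm ℤ : ℝ)) * (W.conductorNorm ℤ : ℝ) ^ (6 + ε) :=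
        mul_le_mul_of_nonneg_right (mul_le_mul_of_nonneg_left hleR hmax0) hN0
    _ = 216 * max C 0 * (W.conductorNorm ℤ : ℝ) ^ (7 + ε) := by rw [hsplit]; ring

/-- **A8 (M/L, NEW) — conductor primes of a cyclic cubic field are `3` or `≡ 1 (mod 3)`** (tame inertia at
`p ≠ 3` is cyclic of order `e = 3` inside `𝔽_p^×`, so `3 ∣ p - 1`).  On the leaf: the allowance is supported on
primes `≡ 1 (3)` (and `3`), all additive of Kodaira type II/IV/IV*/II* (B2).  Not in Mathlib (no tame-inertia
structure); census j345123: 0 violations. [cite: WashingtonCyclotomicFields1997, Lemma 14.? / cyclic cubic conductors] -/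
theorem mod_three_eq_one_of_dvd_discr_of_isGalois (K : Type) [Field K] [NumberField K] [IsGalois ℚ K]
    (hK : Module.finrank ℚ K = 3) {p : ℕ} (hp : p.Prime) (hp3 : p ≠ 3) (hd : (p : ℤ) ∣ NumberField.discr K) :
    p % 3 = 1 := by
  sorry

/-- **A9 (statement; the leaf case of the table B2) — Kummer conductor criterion.** On the cyclic leaf, for a
prime `p ≥ 5`: `p ∣ d_K ⟺ p` is additive, potentially good, with `3 ∤ v_p(Δ_min)` (⟺ `3 ∤ v_π(γ_E)`). -/
def LeafConductorCriterion : Prop :=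
  ∀ (W : WeierstrassCurve ℚ) [W.IsElliptic] (K : Type) [Field K] [NumberField K], IsGalois ℚ K →
    Irreducible W.twoTorsionPolynomial.toPoly → Module.finrank ℚ K = 3 →
    (∃ θ : K, aeval θ W.twoTorsionPolynomial.toPoly = 0) →
    ∀ p : ℕ, p.Prime → 5 ≤ p →
      ((p : ℤ) ∣ NumberField.discr K ↔
        ((W.conductorNorm ℤ).factorization p = 2 ∧ 0 ≤ padicValRat p W.j ∧
          (W.minimalDiscriminantNorm ℤ).factorization p % 3 ≠ 0))

/-! ## §B The K-free allowance (all of the class, prime by prime) -/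

/-- **B1 — the allowance exponent `κ_p(E)` at a prime `p ≥ 5`** (a function of `n_p = v_p(Δ_min)`, `f_p` and
the sign of `v_p(j)` only): (potentially) multiplicative `p`: `n_p mod 2`; potentially good additive `p`:
`(n_p mod 2) + 2·[3 ∤ n_p]` (`= 1` for III/III*, `2` for II/IV/IV*/II*, `0` for I₀*). -/
def kappa (W : WeierstrassCurve ℚ) [W.IsElliptic] (p : ℕ) : ℕ :=
  let n := (W.minimalDiscriminantNorm ℤ).factorization p
  if (W.conductorNorm ℤ).factorization p = 1 ∨ padicValRat p W.j < 0 then n % 2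
  else n % 2 + 2 * (if n % 3 = 0 then 0 else 1)

/-- The K-free allowance `A(E) = ∏_{p ≥ 5, p ∣ N} p^{κ_p(E)}`. -/
def allowanceKfree (W : WeierstrassCurve ℚ) [W.IsElliptic] : ℕ :=
  ∏ p ∈ (W.conductorNorm ℤ).primeFactors.filter (fun p => 5 ≤ p), p ^ kappa W p

/-- **B2 (L; the ALLOWANCE TABLE, sign-free) — `v_p(d_K) = κ_p(E)` for every `p ≥ 5` dividing `N`.**
Derivation: `v_p(d_K)` = Artin conductor exponent of the 2-dimensional representation of `Gal(ℚ(E[2])/ℚ) ≅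
im ρ̄_{E,2} ≤ S₃` = `[e_p(L) = 2] + 2·[3 ∣ e_p(L)]` (tame, `p ≥ 5`); `e_p(L)` = order of `ρ̄_{E,2}(I_p)`:
potentially good ⟹ `I_p` acts through `Φ_p` cyclic of order `12/gcd(12, n_p)`, whose image mod the pro-2
kernel has order `2^[n_p odd]·3^[3 ∤ n_p]`; (potentially) multiplicative ⟹ Tate curve (twisted by a character
trivial mod 2): `e_p(L) = 2^[n_p odd]`.  Multiplicative case = k3-g8 H6 (proved there modulo H1/H2/keystone);
potentially-good and `Iₙ*` cases NEW.  Census j344906 (k3 g8, `> 10⁶` curves, pot. good) and j345123 (this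
page, all cases): 0 violations. [cite: SilvermanATAEC1994, V.4–V.5 and Exercise 5.13 (b)] [cite: Serre1972, §5] -/
def AllowanceTable : Prop :=
  ∀ (W : WeierstrassCurve ℚ) [W.IsElliptic] (K : Type) [Field K] [NumberField K],
    Irreducible W.twoTorsionPolynomial.toPoly → Module.finrank ℚ K = 3 →
    (∃ θ : K, aeval θ W.twoTorsionPolynomial.toPoly = 0) →
    ∀ p : ℕ, p.Prime → 5 ≤ p → p ∣ W.conductorNorm ℤ →
      padicValNat p (NumberField.discr K).natAbs = kappa W p

/-- **B3a (M, bookkeeping from B2 + NOS): `A(E) ∣ |d_K|`.** -/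
def AllowLower : Prop :=
  ∀ (W : WeierstrassCurve ℚ) [W.IsElliptic] (K : Type) [Field K] [NumberField K],
    Irreducible W.twoTorsionPolynomial.toPoly → Module.finrank ℚ K = 3 →
    (∃ θ : K, aeval θ W.twoTorsionPolynomial.toPoly = 0) → allowanceKfree W ∣ (NumberField.discr K).natAbs

/-- **B3b (M, bookkeeping from B2 + tree caps `v₂ ≤ 3`, `v₃ ≤ 5` + NOS): `|d_K| ∣ 1944·A(E)`** (`1944 = 2³3⁵`). -/
def AllowUpper : Prop :=
  ∀ (W : WeierstrassCurve ℚ) [W.IsElliptic] (K : Type) [Field K] [NumberField K],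
    Irreducible W.twoTorsionPolynomial.toPoly → Module.finrank ℚ K = 3 →
    (∃ θ : K, aeval θ W.twoTorsionPolynomial.toPoly = 0) → (NumberField.discr K).natAbs ∣ 1944 * allowanceKfree W

theorem allowLower_of_table (h : AllowanceTable) : AllowLower := by
  sorry

theorem allowUpper_of_table (h : AllowanceTable) : AllowUpper := by
  sorry

/-- **The K-free real stub**: `K` eliminated; the sign is kept as the sign of `Δ` (`0 < d_K ⟺ 0 < Δ`, k2 G7 R1 /
keystone), here as the hypothesis `0 < W.Δ`. -/
def StubRealKfree : Prop :=
  ∀ ε : ℝ, 0 < ε → ∃ C : ℝ, ∀ (W : WeierstrassCurve ℚ) [W.IsElliptic],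
    Irreducible W.twoTorsionPolynomial.toPoly → 0 < W.Δ →
    (W.minimalDiscriminantNorm ℤ : ℝ) ≤ C * (allowanceKfree W : ℝ) * (W.conductorNorm ℤ : ℝ) ^ (6 + ε)

/-- Sign transfer (k1 G5 keystone `2⁸Δ_min·u¹² = I²·d_K`, sketch-proved in this directory; k2 G7 R1):
on class members `0 < d_K ↔ 0 < Δ`.  Hypothesis here. -/
def SignTransfer : Prop :=
  ∀ (W : WeierstrassCurve ℚ) [W.IsElliptic] (K : Type) [Field K] [NumberField K],
    Irreducible W.twoTorsionPolynomial.toPoly → Module.finrank ℚ K = 3 →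
    (∃ θ : K, aeval θ W.twoTorsionPolynomial.toPoly = 0) → (0 < NumberField.discr K ↔ 0 < W.Δ)

/-- Every `W` with irreducible `ψ₂` HAS a class partner `K = ℚ[X]/(ψ₂)` (so the K-free statement loses nothing).
[folklore] -/
def ClassPartnerExists : Prop :=
  ∀ (W : WeierstrassCurve ℚ) [W.IsElliptic], Irreducible W.twoTorsionPolynomial.toPoly →
    ∃ (K : Type) (_ : Field K) (_ : NumberField K), Module.finrank ℚ K = 3 ∧
      ∃ θ : K, aeval θ W.twoTorsionPolynomial.toPoly = 0

/-- **B4 (S, PROVED from B3a/B3b + the two transfers) — `StubRealCubic ↔ StubRealKfree`.** -/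
theorem stubRealCubic_iff_kfree (hl : AllowLower) (hu : AllowUpper) (hs : SignTransfer)
    (hP : ClassPartnerExists) : StubRealCubic ↔ StubRealKfree := by
  constructor
  · intro h ε hε
    obtain ⟨C, hC⟩ := h ε hε
    refine ⟨1944 * max C 0, fun W _ hirr hΔ => ?_⟩
    obtain ⟨K, _, _, hK, hθ⟩ := hP W hirr
    have hd : 0 < NumberField.discr K := (hs W K hirr hK hθ).mpr hΔ
    have h1 := hC W K hirr hK hθ hd
    have hN0 : (0 : ℝ) ≤ (W.conductorNorm ℤ : ℝ) ^ (6 + ε) := Real.rpow_nonneg (Nat.cast_nonneg _) _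
    have hmax0 : (0 : ℝ) ≤ max C 0 := le_max_right _ _
    have hA0 : allowanceKfree W ≠ 0 := by
      refine Finset.prod_ne_zero_iff.mpr fun p hp => pow_ne_zero _ ?_
      exact (Nat.prime_of_mem_primeFactors (Finset.mem_filter.mp hp).1).ne_zero
    have hle : (NumberField.discr K).natAbs ≤ 1944 * allowanceKfree W :=
      Nat.le_of_dvd (Nat.mul_pos (by norm_num) (Nat.pos_of_ne_zero hA0)) (hu W K hirr hK hθ)
    have hleR : |(NumberField.discr K : ℝ)| ≤ 1944 * (allowanceKfree W : ℝ) := by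
      have h' : (((NumberField.discr K).natAbs : ℕ) : ℝ) ≤ 1944 * (allowanceKfree W : ℝ) := by exact_mod_cast hle
      rwa [Nat.cast_natAbs, Int.cast_abs] at h'
    calc (W.minimalDiscriminantNorm ℤ : ℝ) ≤ C * |(NumberField.discr K : ℝ)| * (W.conductorNorm ℤ : ℝ) ^ (6 + ε) := h1
      _ ≤ max C 0 * |(NumberField.discr K : ℝ)| * (W.conductorNorm ℤ : ℝ) ^ (6 + ε) :=
          mul_le_mul_of_nonneg_right (mul_le_mul_of_nonneg_right (le_max_left _ _) (abs_nonneg _)) hN0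
      _ ≤ max C 0 * (1944 * (allowanceKfree W : ℝ)) * (W.conductorNorm ℤ : ℝ) ^ (6 + ε) :=
          mul_le_mul_of_nonneg_right (mul_le_mul_of_nonneg_left hleR hmax0) hN0
      _ = 1944 * max C 0 * (allowanceKfree W : ℝ) * (W.conductorNorm ℤ : ℝ) ^ (6 + ε) := by ring
  · intro h ε hε
    obtain ⟨C, hC⟩ := h ε hε
    refine ⟨max C 0, fun W _ K _ _ hirr hK hθ hd => ?_⟩
    have hΔ : 0 < W.Δ := (hs W K hirr hK hθ).mp hd
    have h1 := hC W hirr hΔ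
    have hN0 : (0 : ℝ) ≤ (W.conductorNorm ℤ : ℝ) ^ (6 + ε) := Real.rpow_nonneg (Nat.cast_nonneg _) _
    have hmax0 : (0 : ℝ) ≤ max C 0 := le_max_right _ _
    have hd0 : (NumberField.discr K).natAbs ≠ 0 := Int.natAbs_ne_zero.mpr (NumberField.discr_ne_zero K)
    have hle : allowanceKfree W ≤ (NumberField.discr K).natAbs :=
      Nat.le_of_dvd (Nat.pos_of_ne_zero hd0) (hl W K hirr hK hθ)
    have hleR : (allowanceKfree W : ℝ) ≤ |(NumberField.discr K : ℝ)| := by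
      have h' : (allowanceKfree W : ℝ) ≤ (((NumberField.discr K).natAbs : ℕ) : ℝ) := by exact_mod_cast hle
      rwa [Nat.cast_natAbs, Int.cast_abs] at h'
    have hA0 : (0 : ℝ) ≤ (allowanceKfree W : ℝ) := Nat.cast_nonneg _
    calc (W.minimalDiscriminantNorm ℤ : ℝ) ≤ C * (allowanceKfree W : ℝ) * (W.conductorNorm ℤ : ℝ) ^ (6 + ε) := h1
      _ ≤ max C 0 * (allowanceKfree W : ℝ) * (W.conductorNorm ℤ : ℝ) ^ (6 + ε) :=
          mul_le_mul_of_nonneg_right (mul_le_mul_of_nonneg_right (le_max_left _ _) hA0) hN0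
      _ ≤ max C 0 * |(NumberField.discr K : ℝ)| * (W.conductorNorm ℤ : ℝ) ^ (6 + ε) :=
          mul_le_mul_of_nonneg_right (mul_le_mul_of_nonneg_left hleR hmax0) hN0

/-! ## §M Message.  §A: on the cyclic leaf the resolvent allowance is void (A7) and `K` is the Kummer class of
the Cardano element in `ℤ[√-3]` (A2', A8, A9); §B: everywhere, `|d_K|` is the explicit function
`2^a 3^b ∏ p^{κ_p(E)}` of the reduction data (B2), so the stub is `StubRealKfree` (B4): odd (potentially)
multiplicative towers get ONE free storey, potentially good primes carry slack `p^{≥ 2}` regardless.  No helper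
implies the stub; the kernel is k2-g4 `OddTowerSzpiro` (= Szpiro-strength).  Verdict unchanged: open-problem. -/

end Summit.ABC.ABC.Cruxes.IndexSzpiro.StubIdeas2RealG9

end
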